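import Summits.QuantumFields.YangMills.Theorems.PoincareLipschitzSobolevCellAverages
import Summits.QuantumFields.YangMills.Theorems.PoincareLipschitzSamplingCells
import HarnessLib

/-!
# LINE 25 «compactness_transfer» (stmt-QuantumFields-23533), S2♭″ brick (Γ5a) «SOBOLEV CELL-AVERAGE ROWS», FILE D —
# (a-iv) THE TILING SUM: `∫_{Q_s} ‖a_R(⌊Rx⌋) − V x‖² ≤ C_P²·R⁻²·∫_Q ‖GV‖²` for the cell averages `a_R` of a Sobolev map on the cube

Cell `ym3-torus` (YM ladder rung R3 — a RUNG, NOT the Clay problem: not d = 4, not infinite volume, not a mass gap); WIDTH COPY «width 15» of ym3-torus-p1,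
gen 6; helper `--supports stmt-QuantumFields-23533`.  THEOREMS ONLY (0 `def`, default heartbeats).  Letters: w7's open grid cell and its half-open twin
`{x | ∀ i, (y i : ℝ)∕R ≤ x i ∧ x i < ((y i : ℝ)+1)∕R}`, the cubes `Q_s = {x | ∀ i, |x i| < s}` (✓`PoincareLipschitzSamplingCells.isOpen_absCube`), labels
`fun i => ⌊(R : ℝ) * x i⌋ : Zd 3` (Γ1's blow-down letter), lit `box 0 N`, `MemSobolevDomain` ∕ `HasWeakFDerivOn`.

WHY (LEAD w1 g10 12:29:32Z S2♭″ ARCHITECTURE v0 (Γ5a) → px15, row (a-iv); GO 12:46:09Z (4)).  The piecewise-constant map `x ↦ a_R(⌊Rx⌋)` built from the cell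
averages of a `W^{1,2}` competitor `V` is `L²(Q_s)`-close to `V`, with the Poincaré–Wirtinger rate `R⁻¹`: tile `Q_s` by the half-open cells with labels in
`box 0 (⌊sR⌋+1)` (pairwise disjoint — `lintegral_biUnion_finset`), drop the null faces (`Measure.pi_hyperplane`), apply FILE B's cell row
★★`exists_eLpNorm_sq_sub_smul_setIntegral_cell_le` on each open cell (Sobolev data fed from the cube by ★`memSobolevDomain_one_two_of_bound` ∕ `hasWeakFDerivOn_mono`),
and re-sum the disjoint open cells inside `Q` (w7 ✓`disjoint_cell`).  CONTENTS: §1 `measurableSet_hcell` · `floor_eq_of_mem_hcell` · `disjoint_hcell` ·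
★`absCube_subset_biUnion_hcell` · `volume_hcell_diff_cell` (faces are null: `Measure.pi_hyperplane`; cf. lit ✓`volume_setOf_apply_eq_zero_three`) · ★`setLIntegral_hcell_eq` · `cell_subset_unitCube` (`N + 1 ≤ R`); §2 `eLpNorm_two_pow_two` ·
★★★`exists_lintegral_sub_cellAverage_sq_le : ∃ C, ∀ R, 0 < R → ∀ s, ⌊sR⌋ + 2 ≤ R → ∀ V GV M, HasWeakFDerivOn ⟨Q⟩ volume V GV → (‖V‖ ≤ M a.e. on Q) →
(∀ v, MemLp (GV·v) 2 (vol|Q)) → ∀ a, (∀ y, a y = R³•∫_{cell_y} V) → ∫⁻_{Q_s} ‖a(⌊Rx⌋) − V x‖ₑ² ≤ C²·ofReal R⁻²·∫⁻_Q ‖GV x‖ₑ²` (the same `C` as FILE B).  HONEST SCOPE: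
NOTHING here proves Γ5, S2♭″, the organ, `BlockLipschitzL`, `HistoryTailL`, or any summit statement; YM₃ on T³ is rung R3, not Clay. [cite: Evans2010, §5.8.1 Thm. 1]
-/

noncomputable section

open MeasureTheory Set Function Filter TopologicalSpace Metric Module
open scoped NNReal ENNReal Topology

namespace Summit.QuantumFields.YangMills.Theorems.PoincareLipschitzSobolevCellTiling

open Literature.Analysis.FunctionSpaces
open Literature.MathematicalPhysics.QuantumFieldTheory.Balaban1983to89
open B4Eq19LatticeOperators (Zd box mem_box)
open Summit.QuantumFields.YangMills.Theorems.PoincareLipschitzSobolevCellAverages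
open Summit.QuantumFields.YangMills.Theorems.PoincareLipschitzSamplingCells
  (disjoint_cell isOpen_absCube measurableSet_cell)

/-! ## §1 Half-open cells: measurability, disjointness, covering, null faces -/

/-- The half-open grid cell `Π [yᵢ∕R, (yᵢ+1)∕R)` is measurable. [folklore] -/
theorem measurableSet_hcell (R : ℕ) (y : Zd 3) :
    MeasurableSet {x : EuclideanSpace ℝ (Fin 3) | ∀ i, (y i : ℝ) / R ≤ x i ∧ x i < ((y i : ℝ) + 1) / R} := by
  have h : {x : EuclideanSpace ℝ (Fin 3) | ∀ i, (y i : ℝ) / R ≤ x i ∧ x i < ((y i : ℝ) + 1) / R} =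
      (WithLp.ofLp : EuclideanSpace ℝ (Fin 3) → (Fin 3 → ℝ)) ⁻¹'
        (Set.pi univ fun i => Ico ((y i : ℝ) / R) (((y i : ℝ) + 1) / R)) := by
    ext x; simp [Set.mem_pi]
  rw [h]
  exact (MeasurableSet.univ_pi fun i => measurableSet_Ico).preimage
    (PiLp.volume_preserving_ofLp (Fin 3)).measurable

/-- On the half-open cell `Π [yᵢ∕R,(yᵢ+1)∕R)` the lattice label is `⌊R x⌋ = y`. [folklore] -/
theorem floor_eq_of_mem_hcell {R : ℕ} (hR : 0 < R) {y : Zd 3} {x : EuclideanSpace ℝ (Fin 3)}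
    (hx : ∀ i, (y i : ℝ) / R ≤ x i ∧ x i < ((y i : ℝ) + 1) / R) :
    (fun i => ⌊(R : ℝ) * x i⌋) = y := by
  have hR0 : (0 : ℝ) < R := by exact_mod_cast hR
  funext i
  obtain ⟨h1, h2⟩ := hx i
  rw [Int.floor_eq_iff]
  constructor
  · have := (div_le_iff₀ hR0).1 h1; linarith
  · have := (lt_div_iff₀ hR0).1 h2; linarith

/-- Distinct labels give disjoint half-open cells. [folklore] -/
theorem disjoint_hcell {R : ℕ} (hR : 0 < R) {y y' : Zd 3} (h : y ≠ y') :
    Disjoint {x : EuclideanSpace ℝ (Fin 3) | ∀ i, (y i : ℝ) / R ≤ x i ∧ x i < ((y i : ℝ) + 1) / R}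
      {x : EuclideanSpace ℝ (Fin 3) | ∀ i, (y' i : ℝ) / R ≤ x i ∧ x i < ((y' i : ℝ) + 1) / R} := by
  rw [Set.disjoint_left]
  intro x hx hx'
  exact h ((floor_eq_of_mem_hcell hR hx).symm.trans (floor_eq_of_mem_hcell hR hx'))

/-- The cube `Q_s = {|xᵢ| < s}` is covered by the half-open cells with labels in
`box 0 (⌊sR⌋ + 1)`. [folklore] -/
theorem absCube_subset_biUnion_hcell {R : ℕ} (hR : 0 < R) (s : ℝ) :
    {x : EuclideanSpace ℝ (Fin 3) | ∀ i : Fin 3, |x i| < s} ⊆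
      ⋃ y ∈ box (0 : Zd 3) (⌊s * R⌋ + 1),
        {x : EuclideanSpace ℝ (Fin 3) | ∀ i, (y i : ℝ) / R ≤ x i ∧ x i < ((y i : ℝ) + 1) / R} := by
  have hR0 : (0 : ℝ) < R := by exact_mod_cast hR
  intro x hx
  rw [Set.mem_iUnion₂]
  refine ⟨fun i => ⌊(R : ℝ) * x i⌋, ?_, fun i => ?_⟩
  · rw [mem_box]
    intro i
    simp only [Pi.zero_apply, sub_zero]
    have hxi := hx i
    rw [abs_lt] at hxi
    rw [abs_le]
    constructor
    · have h1 : -(s * R) < (R : ℝ) * x i := by nlinarith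
      have h2 : ⌊-(s * (R : ℝ))⌋ ≤ ⌊(R : ℝ) * x i⌋ := Int.floor_le_floor h1.le
      have h3 : -(⌊s * (R : ℝ)⌋ + 1) ≤ ⌊-(s * (R : ℝ))⌋ := by
        have h5 : ⌊-(s * (R : ℝ))⌋ = -⌈s * (R : ℝ)⌉ := Int.floor_neg
        have h4 := Int.ceil_le_floor_add_one (s * (R : ℝ))
        omega
      linarith
    · have h1 : (R : ℝ) * x i < s * R := by nlinarith
      have h2 : ⌊(R : ℝ) * x i⌋ ≤ ⌊s * (R : ℝ)⌋ := Int.floor_le_floor h1.le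
      linarith
  · constructor
    · rw [div_le_iff₀ hR0, mul_comm]; exact Int.floor_le _
    · rw [lt_div_iff₀ hR0, mul_comm]; exact Int.lt_floor_add_one _

/-- The half-open cell minus the open cell lies in the three faces `{xᵢ = yᵢ∕R}`, hence is null.
[folklore] -/
theorem volume_hcell_diff_cell (R : ℕ) (y : Zd 3) :
    volume ({x : EuclideanSpace ℝ (Fin 3) | ∀ i, (y i : ℝ) / R ≤ x i ∧ x i < ((y i : ℝ) + 1) / R} \
      {x : EuclideanSpace ℝ (Fin 3) | ∀ i, (y i : ℝ) / R < x i ∧ x i < ((y i : ℝ) + 1) / R}) = 0 := by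
  refine measure_mono_null (t := ⋃ i : Fin 3, {x : EuclideanSpace ℝ (Fin 3) | x i = (y i : ℝ) / R}) ?_ ?_
  · intro x hx
    obtain ⟨h1, h2⟩ := hx
    simp only [Set.mem_setOf_eq, not_forall] at h2
    obtain ⟨i, hi⟩ := h2
    rw [Set.mem_iUnion]
    refine ⟨i, ?_⟩
    have := h1 i
    simp only [Set.mem_setOf_eq]
    by_contra hne
    exact hi ⟨lt_of_le_of_ne this.1 (Ne.symm hne), this.2⟩
  · -- each face `{x | xᵢ = c}` is Lebesgue-null (lit `volume_setOf_apply_eq_zero_three`, re-derived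
    -- here from `Measure.pi_hyperplane` to keep the imports light)
    have hface : ∀ (i : Fin 3) (c : ℝ), volume {x : EuclideanSpace ℝ (Fin 3) | x i = c} = 0 := by
      intro i c
      have h : {x : EuclideanSpace ℝ (Fin 3) | x i = c} =
          (WithLp.ofLp : EuclideanSpace ℝ (Fin 3) → (Fin 3 → ℝ)) ⁻¹' {f | f i = c} := by
        ext x; simp
      rw [h, (PiLp.volume_preserving_ofLp (Fin 3)).measure_preimage]
      · rw [volume_pi]; exact Measure.pi_hyperplane (fun _ : Fin 3 => (volume : Measure ℝ)) i c
      · exact (measurableSet_eq_fun (measurable_pi_apply i) measurable_const).nullMeasurableSet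
    exact (measure_iUnion_null_iff.2 fun i => hface i _)

/-- Integrals over the half-open cell and over the open cell agree (null faces). [folklore] -/
theorem setLIntegral_hcell_eq (R : ℕ) (y : Zd 3) (g : EuclideanSpace ℝ (Fin 3) → ℝ≥0∞) :
    ∫⁻ x in {x : EuclideanSpace ℝ (Fin 3) | ∀ i, (y i : ℝ) / R ≤ x i ∧ x i < ((y i : ℝ) + 1) / R}, g x =
      ∫⁻ x in {x : EuclideanSpace ℝ (Fin 3) | ∀ i, (y i : ℝ) / R < x i ∧ x i < ((y i : ℝ) + 1) / R}, g x := by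
  apply le_antisymm
  · have hsplit : {x : EuclideanSpace ℝ (Fin 3) | ∀ i, (y i : ℝ) / R ≤ x i ∧ x i < ((y i : ℝ) + 1) / R} ⊆
        {x : EuclideanSpace ℝ (Fin 3) | ∀ i, (y i : ℝ) / R < x i ∧ x i < ((y i : ℝ) + 1) / R} ∪
        ({x : EuclideanSpace ℝ (Fin 3) | ∀ i, (y i : ℝ) / R ≤ x i ∧ x i < ((y i : ℝ) + 1) / R} \
          {x : EuclideanSpace ℝ (Fin 3) | ∀ i, (y i : ℝ) / R < x i ∧ x i < ((y i : ℝ) + 1) / R}) := by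
      intro x hx
      by_cases h : x ∈ {x : EuclideanSpace ℝ (Fin 3) | ∀ i, (y i : ℝ) / R < x i ∧ x i < ((y i : ℝ) + 1) / R}
      · exact Or.inl h
      · exact Or.inr ⟨hx, h⟩
    calc _ ≤ _ := lintegral_mono_set hsplit
      _ ≤ _ := lintegral_union_le _ _ _
      _ = _ := by rw [setLIntegral_measure_zero _ _ (volume_hcell_diff_cell R y), add_zero]
  · exact lintegral_mono_set fun x hx i => ⟨(hx i).1.le, (hx i).2⟩

/-- Cells with labels in `box 0 N` lie in the open unit cube `Q` once `N + 1 ≤ R`. [folklore] -/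
theorem cell_subset_unitCube {R : ℕ} (hR : 0 < R) {N : ℤ} (hN : N + 1 ≤ (R : ℤ)) {y : Zd 3}
    (hy : y ∈ box (0 : Zd 3) N) :
    {x : EuclideanSpace ℝ (Fin 3) | ∀ i, (y i : ℝ) / R < x i ∧ x i < ((y i : ℝ) + 1) / R} ⊆
      {x : EuclideanSpace ℝ (Fin 3) | ∀ i : Fin 3, |x i| < 1} := by
  have hR0 : (0 : ℝ) < R := by exact_mod_cast hR
  intro x hx i
  have hyi : |(y i : ℝ)| ≤ N := by
    have h1 : |y i - (0 : Zd 3) i| ≤ N := (mem_box.mp hy) i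
    simp only [Pi.zero_apply, sub_zero] at h1
    exact_mod_cast h1
  have hNR : (N : ℝ) + 1 ≤ R := by exact_mod_cast hN
  obtain ⟨hlo, hhi⟩ := hx i
  rw [abs_le] at hyi
  rw [abs_lt]
  constructor
  · have h4 : -1 ≤ (y i : ℝ) / R := by
      rw [le_div_iff₀ hR0]; linarith [hyi.1]
    linarith
  · have h4 : ((y i : ℝ) + 1) / R ≤ 1 := by
      rw [div_le_iff₀ hR0]; linarith [hyi.2]
    linarith

/-! ## §2 (a-iv) The tiling sum -/

/-- `eLpNorm` squared at `p = 2` is the lower integral of `‖·‖ₑ²`. [folklore] -/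
theorem eLpNorm_two_pow_two {X : Type*} [MeasurableSpace X] {ν : Measure X} {G : Type*}
    [NormedAddCommGroup G] (f : X → G) :
    eLpNorm f 2 ν ^ 2 = ∫⁻ x, ‖f x‖ₑ ^ 2 ∂ν := by
  rw [eLpNorm_eq_lintegral_rpow_enorm_toReal two_ne_zero ENNReal.ofNat_ne_top, ENNReal.toReal_ofNat]
  simp only [ENNReal.rpow_ofNat, one_div]
  rw [← ENNReal.rpow_natCast ((∫⁻ x, ‖f x‖ₑ ^ 2 ∂ν) ^ (2 : ℝ)⁻¹), ← ENNReal.rpow_mul]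
  norm_num

/-- ★★★ **(a-iv) THE TILING SUM**: there is a universal `C` (the constant of FILE B's
`exists_eLpNorm_sq_sub_smul_setIntegral_cell_le`) such that for every `R ≥ 1` and `s` with
`⌊sR⌋ + 2 ≤ R`, every `V` with a weak derivative `GV` on the open unit cube `Q = {|xᵢ| < 1}`, an a.e.
bound `‖V‖ ≤ M` on `Q` and square-integrable `x ↦ GV x v`, and cell averages
`a y = R³ • ∫_{cell_y} V`:
`∫⁻_{Q_s} ‖a(⌊Rx⌋) − V x‖ₑ² ≤ C² · R⁻² · ∫⁻_Q ‖GV x‖ₑ²`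
(tile `Q_s` by the half-open cells with labels in `box 0 (⌊sR⌋+1)`, drop the null faces, apply the
cell Poincaré–Wirtinger row, and re-sum the disjoint open cells inside `Q`). [cite: Evans2010, §5.8.1 Thm. 1] -/
theorem exists_lintegral_sub_cellAverage_sq_le :
    ∃ C : ℝ≥0, ∀ (R : ℕ), 0 < R → ∀ (s : ℝ), ⌊s * R⌋ + 2 ≤ (R : ℤ) →
      ∀ (V : EuclideanSpace ℝ (Fin 3) → EuclideanSpace ℝ (Fin 4))
        (GV : EuclideanSpace ℝ (Fin 3) → EuclideanSpace ℝ (Fin 3) →L[ℝ] EuclideanSpace ℝ (Fin 4)) (M : ℝ),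
      HasWeakFDerivOn (⟨{x : EuclideanSpace ℝ (Fin 3) | ∀ i : Fin 3, |x i| < 1}, isOpen_absCube 1⟩ : Opens _)
        volume V GV →
      (∀ᵐ x ∂(volume.restrict {x : EuclideanSpace ℝ (Fin 3) | ∀ i : Fin 3, |x i| < 1}), ‖V x‖ ≤ M) →
      (∀ v, MemLp (fun x => GV x v) 2 (volume.restrict {x : EuclideanSpace ℝ (Fin 3) | ∀ i : Fin 3, |x i| < 1})) →
      ∀ (a : Zd 3 → EuclideanSpace ℝ (Fin 4)),
      (∀ y, a y = ((R : ℝ) ^ 3) • ∫ x in {x : EuclideanSpace ℝ (Fin 3) |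
          ∀ i, (y i : ℝ) / R < x i ∧ x i < ((y i : ℝ) + 1) / R}, V x) →
      ∫⁻ x in {x : EuclideanSpace ℝ (Fin 3) | ∀ i : Fin 3, |x i| < s},
          ‖a (fun i => ⌊(R : ℝ) * x i⌋) - V x‖ₑ ^ 2 ≤
        (C : ℝ≥0∞) ^ 2 * ENNReal.ofReal (((R : ℝ)⁻¹) ^ 2) *
          ∫⁻ x in {x : EuclideanSpace ℝ (Fin 3) | ∀ i : Fin 3, |x i| < 1}, ‖GV x‖ₑ ^ 2 := by
  obtain ⟨C, hC⟩ := exists_eLpNorm_sq_sub_smul_setIntegral_cell_le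
  refine ⟨C, fun R hR s hsR V GV M hGV hVM hGV2 a ha => ?_⟩
  have hR0 : (0 : ℝ) < R := by exact_mod_cast hR
  set Q : Set (EuclideanSpace ℝ (Fin 3)) := {x | ∀ i : Fin 3, |x i| < 1} with hQ
  set N : ℤ := ⌊s * R⌋ + 1 with hN
  have hN1 : N + 1 ≤ (R : ℤ) := by rw [hN]; linarith
  set hc : Zd 3 → Set (EuclideanSpace ℝ (Fin 3)) := fun y =>
    {x | ∀ i, (y i : ℝ) / R ≤ x i ∧ x i < ((y i : ℝ) + 1) / R} with hhc
  set oc : Zd 3 → Set (EuclideanSpace ℝ (Fin 3)) := fun y =>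
    {x | ∀ i, (y i : ℝ) / R < x i ∧ x i < ((y i : ℝ) + 1) / R} with hoc
  set g : EuclideanSpace ℝ (Fin 3) → ℝ≥0∞ := fun x => ‖a (fun i => ⌊(R : ℝ) * x i⌋) - V x‖ₑ ^ 2
    with hg
  -- (1) tile `Q_s` by the half-open cells and drop the null faces
  have h1 : ∫⁻ x in {x : EuclideanSpace ℝ (Fin 3) | ∀ i : Fin 3, |x i| < s}, g x ≤
      ∑ y ∈ box (0 : Zd 3) N, ∫⁻ x in oc y, g x := by
    calc ∫⁻ x in {x : EuclideanSpace ℝ (Fin 3) | ∀ i : Fin 3, |x i| < s}, g x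
        ≤ ∫⁻ x in ⋃ y ∈ box (0 : Zd 3) N, hc y, g x :=
          lintegral_mono_set (absCube_subset_biUnion_hcell hR s)
      _ = ∑ y ∈ box (0 : Zd 3) N, ∫⁻ x in hc y, g x :=
          lintegral_biUnion_finset (fun y _ y' _ hne => disjoint_hcell hR hne)
            (fun y _ => measurableSet_hcell R y) g
      _ = ∑ y ∈ box (0 : Zd 3) N, ∫⁻ x in oc y, g x :=
          Finset.sum_congr rfl fun y _ => setLIntegral_hcell_eq R y g
  -- (2) on each open cell: the label is `y`, then Poincaré–Wirtinger
  have h2 : ∀ y ∈ box (0 : Zd 3) N, ∫⁻ x in oc y, g x ≤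
      (C : ℝ≥0∞) ^ 2 * ENNReal.ofReal (((R : ℝ)⁻¹) ^ 2) * ∫⁻ x in oc y, ‖GV x‖ₑ ^ 2 := by
    intro y hy
    have hsub : oc y ⊆ Q := cell_subset_unitCube hR hN1 hy
    have hle : (⟨oc y, isOpen_cell R y⟩ : Opens (EuclideanSpace ℝ (Fin 3))) ≤
        (⟨Q, isOpen_absCube 1⟩ : Opens _) := hsub
    have hfin : volume (oc y) ≠ ∞ := by
      rw [hoc]; simp only; rw [volume_cell hR y]; exact ENNReal.ofReal_ne_top
    have hV : MemSobolevDomain 1 2 (⟨oc y, isOpen_cell R y⟩ : Opens _) volume V :=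
      memSobolevDomain_one_two_of_bound hGV hle hfin hVM hGV2
    have hGV' : HasWeakFDerivOn (⟨oc y, isOpen_cell R y⟩ : Opens _) volume V GV :=
      hasWeakFDerivOn_mono hGV hle
    have hPW := hC R hR y V GV hV hGV'
    -- the integrand on the open cell
    have hint : ∫⁻ x in oc y, g x = ∫⁻ x in oc y, ‖V x - a y‖ₑ ^ 2 := by
      refine setLIntegral_congr_fun (measurableSet_cell R y) fun x hx => ?_
      simp only [hg]
      rw [floor_eq_of_mem_hcell hR (fun i => ⟨(hx i).1.le, (hx i).2⟩), ← enorm_neg, neg_sub]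
    rw [hint, ← eLpNorm_two_pow_two, ha y]
    calc _ ≤ (C : ℝ≥0∞) ^ 2 * ENNReal.ofReal (((R : ℝ)⁻¹) ^ 2) *
          eLpNorm GV 2 (volume.restrict (oc y)) ^ 2 := hPW
      _ = _ := by rw [eLpNorm_two_pow_two]
  -- (3) re-sum the disjoint open cells inside `Q`
  have h3 : ∑ y ∈ box (0 : Zd 3) N, ∫⁻ x in oc y, ‖GV x‖ₑ ^ 2 ≤ ∫⁻ x in Q, ‖GV x‖ₑ ^ 2 := by
    rw [← lintegral_biUnion_finset (fun y _ y' _ hne => disjoint_cell hR hne)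
      (fun y _ => measurableSet_cell R y)]
    exact lintegral_mono_set (Set.iUnion₂_subset fun y hy => cell_subset_unitCube hR hN1 hy)
  calc ∫⁻ x in {x : EuclideanSpace ℝ (Fin 3) | ∀ i : Fin 3, |x i| < s}, g x
      ≤ ∑ y ∈ box (0 : Zd 3) N, ∫⁻ x in oc y, g x := h1
    _ ≤ ∑ y ∈ box (0 : Zd 3) N, (C : ℝ≥0∞) ^ 2 * ENNReal.ofReal (((R : ℝ)⁻¹) ^ 2) *
          ∫⁻ x in oc y, ‖GV x‖ₑ ^ 2 := Finset.sum_le_sum h2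
    _ = (C : ℝ≥0∞) ^ 2 * ENNReal.ofReal (((R : ℝ)⁻¹) ^ 2) *
          ∑ y ∈ box (0 : Zd 3) N, ∫⁻ x in oc y, ‖GV x‖ₑ ^ 2 := by rw [Finset.mul_sum]
    _ ≤ (C : ℝ≥0∞) ^ 2 * ENNReal.ofReal (((R : ℝ)⁻¹) ^ 2) * ∫⁻ x in Q, ‖GV x‖ₑ ^ 2 := by
          gcongr

end Summit.QuantumFields.YangMills.Theorems.PoincareLipschitzSobolevCellTiling

end
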